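import Summits.BirchSwinnertonDyer.BirchSwinnertonDyer.Theorems.Rank2ObservatoryRank3Table
import HarnessLib

/-!
# BirchSwinnertonDyer — rank ≥ 2 observatory: decidable equality of rank-3 census rows

HONEST FRAMING: per-curve certified theorems and census instruments; no claim on BSD in rank ≥ 2.

`Rank3Row` (`Rank2ObservatoryRank3Table.lean`) was declared without `DecidableEq` (its rank-2
sibling `Rank2Row` derives it). The rank-3 kernel-certificate index files certify that their row
lists are sublists of the census chunks by a kernel `decide` on `List.Sublist`, which needs the
instance; it is derived here, once, so that every index file shares it. One sanity check
(`sampleRows_sublist`) exercises the instance in the kernel. No data, no axioms beyond the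
derive handler's. [folklore]
-/

-- single-conjunct summit: `Summit.BirchSwinnertonDyer.BirchSwinnertonDyer.…` repeats the name by design
set_option linter.dupNamespace false

namespace Summit.BirchSwinnertonDyer.BirchSwinnertonDyer.Rank2Observatory

deriving instance DecidableEq for Rank3Row

/-- The derived `DecidableEq Rank3Row` reduces in the kernel: a one-row list is a sublist of the
two sample rows of `Rank2ObservatoryRank3Table`, and the two rows are distinct (kernel `decide`).
[folklore] -/
theorem sampleRows_sublist :
    [(⟨"11197a1", 1, -1, 1, -6, 0, 11197, -7, 4419, (0, 0, 1), (-1, 2, 1), (-2, 1, 1)⟩ : Rank3Row)].Sublist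
      [⟨"5077a1", 0, 0, 1, -7, 6, 5077, -7, 285, (1, 0, 1), (2, 0, 1), (0, 2, 1)⟩,
        ⟨"11197a1", 1, -1, 1, -6, 0, 11197, -7, 4419, (0, 0, 1), (-1, 2, 1), (-2, 1, 1)⟩] ∧
    (⟨"5077a1", 0, 0, 1, -7, 6, 5077, -7, 285, (1, 0, 1), (2, 0, 1), (0, 2, 1)⟩ : Rank3Row) ≠
      ⟨"11197a1", 1, -1, 1, -6, 0, 11197, -7, 4419, (0, 0, 1), (-1, 2, 1), (-2, 1, 1)⟩ := by
  decide +kernel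

end Summit.BirchSwinnertonDyer.BirchSwinnertonDyer.Rank2Observatory
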